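import Literature.NumberTheory.Automorphic.Liu2021.AppendixC.DefC4
import Literature.AlgebraicGeometry.ShimuraVarieties.UnitaryBallQuotientDatum
import HarnessLib

/-!
# Liu 2021, App. C, Def. C.4 — auxiliary lemmas (READING N4 of `DefC4.lean` made precise)

Companion of `Literature/NumberTheory/Automorphic/Liu2021/AppendixC/DefC4.lean` (the statement-exact typing of
[Liu2021, Def. C.4], `FJcycle.tex` l. 4620–4622; lead naming ruling: auxiliary lemmas go in `<Name>Aux.lean`, the typed
interface file is landed once).  Proved here, for a matrix `J ∈ M_n(K)` hermitian with respect to an involution `c`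
(`c (J i j) = J j i`) and embeddings `τ' : K →+* ℂ` intertwining `c` with complex conjugation (automatic for a CM field,
Mathlib `IsCMField.complexEmbedding_complexConj`):

* `map_conjugate_eq_transpose` : `J^{\bar τ'} = (J^{τ'})ᵀ`;
* `exists_congr_transpose` : `Tᴴ A T = D`, `Dᵀ = D` ⟹ `(\bar T)ᴴ Aᵀ \bar T = D`;
* `congr_signatureDiag_conjugate`, `congr_signatureDiag_of_mk_eq` : the Sylvester congruence `∃ T ∈ GL_n(ℂ), Tᴴ J^{τ'} T =
  diag(I_p, −I_q)` depends only on the archimedean place of `τ'`;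
* `HasSignatureAt.congr_of_liesAbove` : for a CM field `E` and `τ ∈ Φ_{E⁺}`, `HasSignatureAt τ J p q` (stated in `DefC4.lean`
  with SOME embedding above `τ`, the form l. 4573 uses) gives the congruence at EVERY embedding above `τ` — READING N4 of
  `DefC4.lean`: «the signature of `V ⊗_{F,τ} ℝ`» (l. 4558) does not depend on the identification `V ⊗_{E,τ^−} ℂ ≅ ℂ^{⊕n}`.

READING N1 (presentation by matrices) made precise — BASIS INDEPENDENCE: the matrices of one form `( , )_V` in two bases
are congruent, `J ↦ (c P)ᵀ · J · P` with `P ∈ GL_n(E)`, and every clause of Def. C.4 is invariant under this: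
`IsometricFinite.congr` (uses only `E → 𝔸_E^∞` intertwining `c` with `c ⊗ 1`, tree `FiniteAdeleRing.smul_algebraMap`),
`IsometricAt.congr`, `HasSignatureAt.congr` (these two under `φ ∘ c = conj ∘ φ` for the embeddings involved — a CM
extension), `IsNearby.congr`.

BRIDGE to the CorCM side: `signatureDiag_succ_one : signatureDiag (p+1) 1 = signatureMatrix p` (the tree's `diag(1,…,1,−1)` of
`UnitaryBallQuotientDatum`, used by `HermSpace3.signature_ι₁`) and `hasSignatureAt_of_signatureMatrix` (a Sylvester form
`Tᴴ J^{τ'} T = signatureMatrix p` at an embedding `τ'` above `τ` gives `HasSignatureAt τ J p 1`).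

NON-VACUITY of the typed predicate: `isNearby_neg_one` (rank one, matrix `(−1)`, its coherent adelisation; bookkeeping only —
Liu's `𝕍` is incoherent, a hypothesis on the object outside Def. C.4).

No definitions, no named facts; nothing here is a result of [Liu2021] (linear algebra bookkeeping on the typing).

## References

* [Liu2021] Y. Liu, *Fourier–Jacobi cycles and arithmetic relative trace formula*, Camb. J. Math. 9 (2021) 1–147,
  arXiv:2102.11518 — App. C l. 4558, 4573, Def. C.4 (l. 4620–4622).
-/

noncomputable section

open NumberField NumberField.InfinitePlace IsDedekindDomain
open scoped Matrix

namespace Literature.NumberTheory.Automorphic.Liu2021.AppendixC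

/-! ## READING N4: the choice of the embedding above `τ` is immaterial for a hermitian matrix -/

section ReadingN4

variable {K : Type} [Field K] {n : ℕ}

/-- For `J` hermitian with respect to an involution `c` of `K` (`c (J i j) = J j i`) and an embedding `τ' : K →+* ℂ`
intertwining `c` with complex conjugation, the matrix of `J` at the conjugate embedding `\bar τ'` is the TRANSPOSE of its
matrix at `τ'`. [cite: Liu2021, App. C l. 4558, 4573] -/
theorem map_conjugate_eq_transpose (c : K →+* K) (J : Matrix (Fin n) (Fin n) K) (hJ : ∀ i j, c (J i j) = J j i)
    (τ' : K →+* ℂ) (hτ' : ∀ x, τ' (c x) = starRingEnd ℂ (τ' x)) :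
    J.map (NumberField.ComplexEmbedding.conjugate τ') = (J.map τ')ᵀ := by
  ext i j
  simp only [Matrix.map_apply, Matrix.transpose_apply, NumberField.ComplexEmbedding.conjugate_coe_eq]
  rw [← hτ', hJ]

/-- Congruence to a symmetric target passes to the transpose: if `Tᴴ A T = D` with `Dᵀ = D` then
`(\bar T)ᴴ Aᵀ \bar T = D`. [cite: Liu2021, App. C l. 4573] -/
theorem exists_congr_transpose {A D : Matrix (Fin n) (Fin n) ℂ} (hD : Dᵀ = D) (T : GL (Fin n) ℂ)
    (h : (T : Matrix (Fin n) (Fin n) ℂ)ᴴ * A * (T : Matrix (Fin n) (Fin n) ℂ) = D) :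
    ∃ T' : GL (Fin n) ℂ, (T' : Matrix (Fin n) (Fin n) ℂ)ᴴ * Aᵀ * (T' : Matrix (Fin n) (Fin n) ℂ) = D := by
  refine ⟨Matrix.GeneralLinearGroup.map (starRingEnd ℂ) T, ?_⟩
  have hT' : ((Matrix.GeneralLinearGroup.map (starRingEnd ℂ) T : GL (Fin n) ℂ) : Matrix (Fin n) (Fin n) ℂ) =
      (T : Matrix (Fin n) (Fin n) ℂ)ᵀᴴ := by
    ext i j
    rfl
  have key := congrArg Matrix.transpose h
  rw [Matrix.transpose_mul, Matrix.transpose_mul, hD, ← Matrix.mul_assoc] at key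
  rw [hT', Matrix.conjTranspose_conjTranspose]
  -- key : Tᵀ * Aᵀ * Tᴴᵀ = D ; goal : Tᵀ * Aᵀ * Tᵀᴴ = D
  exact key

/-- `diag(I_p, −I_q)` is symmetric. [cite: Liu2021, App. C l. 4573] -/
theorem signatureDiag_transpose (n q : ℕ) : (signatureDiag n q)ᵀ = signatureDiag n q := by
  unfold signatureDiag
  exact Matrix.diagonal_transpose _

/-- **READING N4, matrix form.**  For `J ∈ M_n(K)` hermitian with respect to an involution `c` (`c (J i j) = J j i`) and an
embedding `τ'` with `τ' ∘ c = conj ∘ τ'`: if `J^{τ'}` is congruent to `diag(I_p, −I_q)` then so is `J^{\bar τ'}` (it is the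
transpose `(J^{τ'})ᵀ`, congruent via `\bar T`).  [cite: Liu2021, App. C l. 4558, 4573] -/
theorem congr_signatureDiag_conjugate (c : K →+* K) (J : Matrix (Fin n) (Fin n) K) (hJ : ∀ i j, c (J i j) = J j i)
    (τ' : K →+* ℂ) (hτ' : ∀ x, τ' (c x) = starRingEnd ℂ (τ' x)) {q : ℕ}
    (h : ∃ T : GL (Fin n) ℂ, (T : Matrix (Fin n) (Fin n) ℂ)ᴴ * J.map τ' * (T : Matrix (Fin n) (Fin n) ℂ) =
      signatureDiag n q) :
    ∃ T : GL (Fin n) ℂ, (T : Matrix (Fin n) (Fin n) ℂ)ᴴ * J.map (NumberField.ComplexEmbedding.conjugate τ') *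
      (T : Matrix (Fin n) (Fin n) ℂ) = signatureDiag n q := by
  obtain ⟨T, hT⟩ := h
  rw [map_conjugate_eq_transpose c J hJ τ' hτ']
  exact exists_congr_transpose (signatureDiag_transpose n q) T hT

/-- **READING N4, place form.**  Under the same hypotheses for EVERY embedding (`∀ τ', τ' ∘ c = conj ∘ τ'`, automatic for a CM
field, Mathlib `IsCMField.complexEmbedding_complexConj`), the Sylvester congruence of `J^{τ'}` to `diag(I_p, −I_q)` depends
only on the archimedean PLACE of `τ'`: two embeddings defining the same place are equal or complex conjugate (Mathlib
`InfinitePlace.mk_eq_iff`). [cite: Liu2021, App. C l. 4558, 4573] -/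
theorem congr_signatureDiag_of_mk_eq (c : K →+* K) (J : Matrix (Fin n) (Fin n) K) (hJ : ∀ i j, c (J i j) = J j i)
    (hc : ∀ (φ : K →+* ℂ) (x : K), φ (c x) = starRingEnd ℂ (φ x)) {τ' τ'' : K →+* ℂ}
    (hw : NumberField.InfinitePlace.mk τ'' = NumberField.InfinitePlace.mk τ') {q : ℕ}
    (h : ∃ T : GL (Fin n) ℂ, (T : Matrix (Fin n) (Fin n) ℂ)ᴴ * J.map τ' * (T : Matrix (Fin n) (Fin n) ℂ) =
      signatureDiag n q) :
    ∃ T : GL (Fin n) ℂ, (T : Matrix (Fin n) (Fin n) ℂ)ᴴ * J.map τ'' * (T : Matrix (Fin n) (Fin n) ℂ) =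
      signatureDiag n q := by
  rcases NumberField.InfinitePlace.mk_eq_iff.mp hw.symm with h₁ | h₁
  · rw [← h₁]; exact h
  · rw [← h₁]; exact congr_signatureDiag_conjugate c J hJ τ' (hc τ') h

end ReadingN4

section ReadingN4CM

variable {E : Type} [Field E] [NumberField E] [NumberField.IsCMField E] {n : ℕ}

open NumberField in
/-- **READING N4 for a CM field `E` (the setting of l. 4550: `E/F` totally imaginary quadratic over `F` totally real, so `E`
is CM with `E⁺ ≃ F`, Mathlib `IsCMField.ofCMExtension`).**  For `J ∈ M_n(E)` hermitian with respect to complex conjugation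
`c` and `τ ∈ Φ_{E⁺}`: if «`V ⊗_{E⁺,τ} ℝ` has signature `(p, q)`» holds through ONE embedding above `τ` (`HasSignatureAt`), the
Sylvester congruence holds at EVERY embedding `τ''` above `τ` — the two embeddings above a real place of `E⁺` define the
same place of `E` (Mathlib `IsCMField.equivInfinitePlace`) and are complex conjugate.  So the `∃ τ'` in `HasSignatureAt` may be
read as `∀ τ'`, as the printed phrase «the signature of `V ⊗_{F,τ} ℝ`» presumes. [cite: Liu2021, App. C l. 4558, 4573] -/
theorem HasSignatureAt.congr_of_liesAbove {τ : (maximalRealSubfield E) →+* ℝ} {J : Matrix (Fin n) (Fin n) E} {p q : ℕ}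
    (hJ : ∀ i j, IsCMField.complexConj E (J i j) = J j i) (h : HasSignatureAt τ J p q)
    (τ'' : E →+* ℂ) (hτ'' : LiesAbove τ'' τ) :
    ∃ T : GL (Fin n) ℂ, (T : Matrix (Fin n) (Fin n) ℂ)ᴴ * J.map τ'' * (T : Matrix (Fin n) (Fin n) ℂ) =
      signatureDiag n q := by
  obtain ⟨-, τ', hτ', hT⟩ := h
  have hmk : InfinitePlace.mk τ'' = InfinitePlace.mk τ' := by
    apply (IsCMField.equivInfinitePlace (K := E)).injective
    rw [IsCMField.equivInfinitePlace_apply, IsCMField.equivInfinitePlace_apply, InfinitePlace.comap_mk,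
      InfinitePlace.comap_mk]
    congr 1
    ext x
    change τ'' (algebraMap _ E x) = τ' (algebraMap _ E x)
    rw [hτ'' x, hτ' x]
  exact congr_signatureDiag_of_mk_eq ((IsCMField.complexConj E : E ≃ₐ[maximalRealSubfield E] E) : E →+* E) J hJ
    (fun φ x => IsCMField.complexEmbedding_complexConj E φ x) hmk hT

end ReadingN4CM

/-! ## Basis independence: the clauses of Def. C.4 are invariant under congruence `J ↦ (c P)ᵀ J P`, `P ∈ GL_n(E)` -/

section Congruence

/-- Ring-algebra identity behind «isometry classes do not depend on the basis»: conjugating a congruence by a further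
change of coordinates. [cite: Liu2021, App. C l. 4558] -/
theorem transpose_map_mul_congr {A : Type} [CommRing A] {n : ℕ} (σ : A →+* A) (X Y J : Matrix (Fin n) (Fin n) A) :
    (Y.map σ)ᵀ * ((X.map σ)ᵀ * J * X) * Y = ((X * Y).map σ)ᵀ * J * (X * Y) := by
  simp only [Matrix.map_mul, Matrix.transpose_mul, Matrix.mul_assoc]

variable (F : Type) {E : Type} [Field F] [Field E] [NumberField E] [Algebra F E] (c : E ≃ₐ[F] E) {n : ℕ}

/-- The diagonal embedding `E → 𝔸_E^∞` intertwines `c` with `c ⊗ 1` (tree `FiniteAdeleRing.smul_algebraMap`), entrywise on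
matrices. [cite: Liu2021, Def. C.3 (l. 4614: «the (induced) involution `c` on `𝔸_E`»)] -/
theorem map_conj_map_algebraMap (P : Matrix (Fin n) (Fin n) E) :
    (P.map (c : E →+* E)).map (algebraMap E (IsDedekindDomain.FiniteAdeleRing (𝓞 E) E)) =
      (P.map (algebraMap E (IsDedekindDomain.FiniteAdeleRing (𝓞 E) E))).map (UnitaryGroup.conjFiniteAdele F E c) := by
  ext i j
  simp only [Matrix.map_apply, UnitaryGroup.conjFiniteAdele_apply, FiniteAdeleRing.smul_algebraMap]
  rfl

/-- **The finite-adelic clause is basis independent**: `IsometricFinite` is invariant under `J ↦ (c P)ᵀ · J · P` for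
`P ∈ GL_n(E)` (the matrix of the same form `( , )_V` in another basis). [cite: Liu2021, Def. C.4 (l. 4621)] -/
theorem IsometricFinite.congr {J : Matrix (Fin n) (Fin n) E} {𝕁 : Matrix (Fin n) (Fin n) (AdeleRing (𝓞 E) E)}
    (h : IsometricFinite F c J 𝕁) (P : GL (Fin n) E) :
    IsometricFinite F c (((P : Matrix (Fin n) (Fin n) E).map (c : E →+* E))ᵀ * J * (P : Matrix (Fin n) (Fin n) E)) 𝕁 := by
  obtain ⟨g, hg⟩ := h
  set ι := algebraMap E (IsDedekindDomain.FiniteAdeleRing (𝓞 E) E) with hι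
  set Q : GL (Fin n) (IsDedekindDomain.FiniteAdeleRing (𝓞 E) E) := Matrix.GeneralLinearGroup.map ι P with hQ
  refine ⟨Q⁻¹ * g, ?_⟩
  have hQcoe : ((Q : GL (Fin n) _) : Matrix (Fin n) (Fin n) _) = (P : Matrix (Fin n) (Fin n) E).map ι := rfl
  have hJ' : ((((P : Matrix (Fin n) (Fin n) E).map (c : E →+* E))ᵀ * J * (P : Matrix (Fin n) (Fin n) E)).map ι) =
      (((Q : GL (Fin n) _) : Matrix (Fin n) (Fin n) _).map (UnitaryGroup.conjFiniteAdele F E c))ᵀ * J.map ι *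
        ((Q : GL (Fin n) _) : Matrix (Fin n) (Fin n) _) := by
    rw [Matrix.map_mul, Matrix.map_mul, Matrix.transpose_map, hQcoe, map_conj_map_algebraMap F c]
  rw [hJ', transpose_map_mul_congr, ← Units.val_mul, mul_inv_cancel_left]
  exact hg

/-- **The archimedean clauses are basis independent**: `IsometricAt w` is invariant under `J ↦ (c P)ᵀ · J · P`, `P ∈ GL_n(E)`,
when the embedding `w.embedding` intertwines `c` with complex conjugation (a CM extension). [cite: Liu2021, Def. C.4 (l. 4621)] -/
theorem IsometricAt.congr {w : InfinitePlace E} (hc : ∀ x : E, w.embedding (c x) = starRingEnd ℂ (w.embedding x))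
    {J : Matrix (Fin n) (Fin n) E} {𝕁 : Matrix (Fin n) (Fin n) (AdeleRing (𝓞 E) E)} (h : IsometricAt w J 𝕁)
    (P : GL (Fin n) E) :
    IsometricAt w (((P : Matrix (Fin n) (Fin n) E).map (c : E →+* E))ᵀ * J * (P : Matrix (Fin n) (Fin n) E)) 𝕁 := by
  obtain ⟨T, hT⟩ := h
  set Q : GL (Fin n) ℂ := Matrix.GeneralLinearGroup.map w.embedding P with hQ
  refine ⟨Q⁻¹ * T, ?_⟩
  have hQcoe : ((Q : GL (Fin n) ℂ) : Matrix (Fin n) (Fin n) ℂ) = (P : Matrix (Fin n) (Fin n) E).map w.embedding := rfl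
  have hPc : ((P : Matrix (Fin n) (Fin n) E).map (c : E →+* E)).map w.embedding =
      ((P : Matrix (Fin n) (Fin n) E).map w.embedding).map (starRingEnd ℂ) := by
    ext i j
    simp only [Matrix.map_apply]
    exact hc _
  have hJ' : ((((P : Matrix (Fin n) (Fin n) E).map (c : E →+* E))ᵀ * J * (P : Matrix (Fin n) (Fin n) E)).map
      w.embedding) = (((Q : GL (Fin n) ℂ) : Matrix (Fin n) (Fin n) ℂ).map (starRingEnd ℂ))ᵀ * J.map w.embedding *
        ((Q : GL (Fin n) ℂ) : Matrix (Fin n) (Fin n) ℂ) := by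
    rw [Matrix.map_mul, Matrix.map_mul, Matrix.transpose_map, hPc, hQcoe]
  have hconj : ∀ M : Matrix (Fin n) (Fin n) ℂ, Mᴴ = (M.map (starRingEnd ℂ))ᵀ := fun M => by
    rw [← Matrix.transpose_map]; rfl
  rw [hJ', hconj, transpose_map_mul_congr, ← Units.val_mul, mul_inv_cancel_left, ← hconj]
  exact hT

omit [NumberField E] in
/-- **The signature clause is basis independent**: `HasSignatureAt τ` is invariant under `J ↦ (c P)ᵀ · J · P`, `P ∈ GL_n(E)`,
when every embedding intertwines `c` with complex conjugation (a CM extension). [cite: Liu2021, Def. C.4 (l. 4622), l. 4573] -/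
theorem HasSignatureAt.congr (hc : ∀ (φ : E →+* ℂ) (x : E), φ (c x) = starRingEnd ℂ (φ x)) {τ : F →+* ℝ}
    {J : Matrix (Fin n) (Fin n) E} {p q : ℕ} (h : HasSignatureAt τ J p q) (P : GL (Fin n) E) :
    HasSignatureAt τ (((P : Matrix (Fin n) (Fin n) E).map (c : E →+* E))ᵀ * J * (P : Matrix (Fin n) (Fin n) E)) p q := by
  obtain ⟨hpq, τ', hτ', T, hT⟩ := h
  refine ⟨hpq, τ', hτ', ?_⟩
  set Q : GL (Fin n) ℂ := Matrix.GeneralLinearGroup.map τ' P with hQ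
  refine ⟨Q⁻¹ * T, ?_⟩
  have hQcoe : ((Q : GL (Fin n) ℂ) : Matrix (Fin n) (Fin n) ℂ) = (P : Matrix (Fin n) (Fin n) E).map τ' := rfl
  have hPc : ((P : Matrix (Fin n) (Fin n) E).map (c : E →+* E)).map τ' =
      ((P : Matrix (Fin n) (Fin n) E).map τ').map (starRingEnd ℂ) := by
    ext i j
    simp only [Matrix.map_apply]
    exact hc _ _
  have hJ' : ((((P : Matrix (Fin n) (Fin n) E).map (c : E →+* E))ᵀ * J * (P : Matrix (Fin n) (Fin n) E)).map τ') =
      (((Q : GL (Fin n) ℂ) : Matrix (Fin n) (Fin n) ℂ).map (starRingEnd ℂ))ᵀ * J.map τ' *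
        ((Q : GL (Fin n) ℂ) : Matrix (Fin n) (Fin n) ℂ) := by
    rw [Matrix.map_mul, Matrix.map_mul, Matrix.transpose_map, hPc, hQcoe]
  have hconj : ∀ M : Matrix (Fin n) (Fin n) ℂ, Mᴴ = (M.map (starRingEnd ℂ))ᵀ := fun M => by
    rw [← Matrix.transpose_map]; rfl
  rw [hJ', hconj, transpose_map_mul_congr, ← Units.val_mul, mul_inv_cancel_left, ← hconj]
  exact hT

/-- **Def. C.4 is basis independent** (READING N1 made precise): for a CM-type involution (`φ ∘ c = conj ∘ φ` for every
`φ ∈ Φ_E`), `IsNearby F c 𝕁 τ J → IsNearby F c 𝕁 τ ((c P)ᵀ J P)` for every `P ∈ GL_n(E)` — the matrices of one form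
`( , )_V` in two bases are so related. [cite: Liu2021, Def. C.4 (l. 4620–4622)] -/
theorem IsNearby.congr (hc : ∀ (φ : E →+* ℂ) (x : E), φ (c x) = starRingEnd ℂ (φ x)) {τ : F →+* ℝ}
    {J : Matrix (Fin n) (Fin n) E} {𝕁 : Matrix (Fin n) (Fin n) (AdeleRing (𝓞 E) E)} (h : IsNearby F c 𝕁 τ J)
    (P : GL (Fin n) E) :
    IsNearby F c 𝕁 τ (((P : Matrix (Fin n) (Fin n) E).map (c : E →+* E))ᵀ * J * (P : Matrix (Fin n) (Fin n) E)) :=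
  ⟨⟨h.1.1.congr F c P, fun w hw => (h.1.2 w hw).congr F c (hc w.embedding) P⟩, h.2.congr F c hc P⟩

end Congruence

/-! ## Bridge to the tree's `signatureMatrix p = diag(1, …, 1, −1)` (BMM; `HermSpace3.signature_ι₁`) -/

section SignatureMatrixBridge

variable {F E : Type} [Field F] [Field E] [Algebra F E]

/-- `diag(I_p, −I_1)` of l. 4573 (`signatureDiag (p+1) 1`) is the tree's standard Gram matrix `signatureMatrix p =
diag(1, …, 1, −1)` of signature `(p, 1)` (file `UnitaryBallQuotientDatum`, used by `HermSpace3.signature_ι₁` on the CorCM side).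
[cite: Liu2021, App. C l. 4573] -/
theorem signatureDiag_succ_one (p : ℕ) :
    signatureDiag (p + 1) 1 = Literature.AlgebraicGeometry.ShimuraVarieties.signatureMatrix p := by
  unfold signatureDiag Literature.AlgebraicGeometry.ShimuraVarieties.signatureMatrix
  congr 1
  funext i
  by_cases h : i = Fin.last p
  · subst h
    simp
  · have hi : (i : ℕ) < p := Fin.val_lt_last h
    simp [h, hi]

/-- The signature clause of Def. C.4 from a Sylvester form in the tree's convention: if `τ' ∈ Φ_E` lies above `τ` and
`Tᴴ · J^{τ'} · T = diag(1, …, 1, −1)` for some `T ∈ GL_{p+1}(ℂ)`, then «`V ⊗_{F,τ} ℝ` has signature `(p, 1)`»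
(`HasSignatureAt τ J p 1`; for `p = n − 1` the second clause of Def. C.4). [cite: Liu2021, Def. C.4 (l. 4621–4622), l. 4573] -/
theorem hasSignatureAt_of_signatureMatrix {p : ℕ} (τ : F →+* ℝ) (J : Matrix (Fin (p + 1)) (Fin (p + 1)) E)
    (τ' : E →+* ℂ) (hτ' : LiesAbove τ' τ)
    (h : ∃ T : GL (Fin (p + 1)) ℂ, (T : Matrix (Fin (p + 1)) (Fin (p + 1)) ℂ)ᴴ * J.map τ' *
      (T : Matrix (Fin (p + 1)) (Fin (p + 1)) ℂ) = Literature.AlgebraicGeometry.ShimuraVarieties.signatureMatrix p) :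
    HasSignatureAt τ J p 1 := by
  refine ⟨rfl, τ', hτ', ?_⟩
  rw [signatureDiag_succ_one]
  exact h

end SignatureMatrixBridge

/-! ## Non-vacuity of the typed predicate (bookkeeping; not a statement about Liu's `𝕍`) -/

section NonVacuity

variable (F : Type) {E : Type} [Field F] [Field E] [NumberField E] [Algebra F E] (c : E ≃ₐ[F] E)

/-- The binder-free predicate `IsNearby` is inhabited: for `n = 1`, the rank-one form with matrix `(−1)` over `E` is
`τ`-nearby (in the typed sense) to its own coherent adelisation `(−1) ⊗ 1` over `𝔸_E`, for every `τ ∈ Φ_F` having an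
embedding `τ' ∈ Φ_E` above it (`g = 1` finite-adelically, `T = 1` at every archimedean place, signature `(0, 1)` at `τ`).
This only certifies that the clauses are jointly satisfiable as typed; Liu's `𝕍` is INCOHERENT and totally positive
definite (Def. C.3, l. 4618), which `(−1) ⊗ 1` is not — those are hypotheses on the object, outside Def. C.4.
[cite: Liu2021, Def. C.4 (l. 4620–4622)] -/
theorem isNearby_neg_one (τ : F →+* ℝ) (τ' : E →+* ℂ) (hτ' : LiesAbove τ' τ) :
    IsNearby F c ((-1 : Matrix (Fin 1) (Fin 1) E).map (algebraMap E (AdeleRing (𝓞 E) E))) τ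
      (-1 : Matrix (Fin 1) (Fin 1) E) := by
  refine ⟨⟨isometricFinite_self F c _, fun w _ => isometricAt_self w _⟩, ⟨rfl, τ', hτ', 1, ?_⟩⟩
  rw [Units.val_one, Matrix.conjTranspose_one, Matrix.one_mul, Matrix.mul_one]
  ext i j
  fin_cases i; fin_cases j
  simp [signatureDiag]

end NonVacuity

end Literature.NumberTheory.Automorphic.Liu2021.AppendixC

end
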